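import Literature.NumberTheory.Automorphic.ArchEndoscopicStableClasses           -- FILE A (this brick): `setOf_isArchStablyConjH_out_eq_range`, `injective_conjClassesMk_flip`, `eq_of_isConj_gl_fin_one`
import Literature.NumberTheory.Automorphic.ArchEndoscopicCentralDescent          -- ★ (R3-f)2b p841432: the measure family `M(S, u, ε)` the descent eats
import Literature.NumberTheory.Automorphic.ArchTorusOrbitalFubini                -- ★ (V7): the product-measure convention on `U(diag α)_∞` ((h0), (h1))
import Literature.NumberTheory.Automorphic.UnitaryGroupArchTopology              -- ★ instances: `arch` locally compact, second countable, T₂, σ-compact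
import Literature.NumberTheory.Automorphic.ArchEndoscopicTorusCayleyFrame          -- ★ B-p12 (V9): `antidiagOne_map`, `coe_inv_cayleyTwo`, `cayley_conj_circleDiagonal_mem_archLocal` (the Cayley frame of `U(Φ₂)(ℂ)`)
import Literature.NumberTheory.Automorphic.ArchCongruenceOrbitalTransport          -- ★ (T-d) FILE 1: `formCongr_map_mixedEmbedding_archFormOf_eq`, `map_evalC_map_mixedEmbedding`
import Literature.NumberTheory.Automorphic.UnitaryGroupArchimedean               -- ★ `isCompact_arch_cm`
import Mathlib.MeasureTheory.Group.Integral
import Mathlib.MeasureTheory.Measure.Haar.Unique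
import Mathlib.MeasureTheory.Integral.Prod
import HarnessLib

/-!
# The `H`-side class bookkeeping for Lemma 14.5.2 (c) at `∞`: at a regular torus point of `H_∞ = U(Φ₂)(L ⊗ ℝ) × U(Φ₁)(L ⊗ ℝ)` the Haar-currency stable sum
# `Σ_{[γ] ⊂ st} ∫_{H_∞} aH(h γ h⁻¹) dνH` is a positive constant times the flip-symmetrised product orbital integral `Σ_ε ∫ aH d(⊗_w conj(diag u_w^{ε_w})_* ν_w)`
# on the diagonalised 2-block (Rogawski 1990 §4.9, §14.3, p. 238; Borel–Jacquet §4.1)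

Topic `NumberTheory/Automorphic`; namespace `Literature.NumberTheory.Automorphic.UnitaryGroup`.  THEOREMS ONLY (no `def`, no instance, no notation, no axiom, no named fact, no `sorry`).
Cell `pub/hodgecm-mathlib`, ENGINE T1 (crux H413 = `stmt-HodgeConjecture-24833`); ROAD-Sd residual R3 «(S-c) central vanishing» (`stub_ScCore` of `Cruxes/H413/Lines/F0_P3a_SdArch.lean`), brick
**(3H) «H-SIDE CLASS BOOKKEEPING»**, FILE B (measure theory; FILE A = `ArchEndoscopicStableClasses`) of the STEP-3 integration map (`CENSUS-R3-STEP3-Integration.F0P3a-p03g10.md` b54b3c40, pen of record F0P3a-p03 (g10); LEAD WORDS T8-76 (C), T8-79 (1));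
author F0P3a-p02 (g11), 2026-09-01.

WHY.  ★ `ArchDeltaTransferHaarForm` ((E1), p841341) reads (vi) at a `G`-regular `γ_H` in HAAR currency: its `H`-side is `∑ᶠ_{c : γ_H ∼st out c} ∫_{H_∞} aH(h·out c·h⁻¹) dνH(h)`.
★ `ArchEndoscopicCentralDescent` ((E2), p841432) descends to the centre along the symmetrised mixed orbital integrals `Σ_{ε : W → Bool} ∫ Θ d(⊗_w M(S, u, ε)_w)` on the product
`Π_w U(σ_w diag α)(ℂ)` of the DIAGONALISED 2-block (★ (R3-a) `Φ₂ = c(Q₂)ᵀ·diag(½,−½)·Q₂`).  This file identifies the two at `S =` all places: for `γ_H = (ψ⁻¹ t(u), δ)` with `u` regular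
(`u_w 0 ≠ u_w 1` at every place) and ANY `δ` in the abelian factor `U(Φ₁)(L ⊗ ℝ) ≅ Π_w U(1)`,
  `∑ᶠ_{c : γ_H ∼st out c} ∫_{H_∞} aH(h·out c·h⁻¹) dνH = κ · Σ_ε ∫ aH(ψ⁻¹ e⁻¹ o, δ) d(⊗_w conj(diag(u_w^{ε_w}))_* ν_w)(o)`,
with ONE constant `κ > 0` depending only on the measures (`νH`, `ν_w`) and the frame — not on `aH`, `u`, `δ`.  Ingredients: (i) the classes of `H_∞` inside the stable class of `γ_H` are
EXACTLY the `2^{#W}` flips `ε` (★ (V8) at `N = 2`: the 2-block form has signature `(1,1)` at EVERY place, so `diag(a,b) ≁ diag(b,a)` in `U(1,1)`, while the `U(Φ₁)`-component of a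
stable conjugate is EQUAL — `GL₁` is commutative); (ii) `∫_{H_∞} aH(h·out c·h⁻¹) dνH` does not depend on the representative (right invariance); (iii) `νH = κ₁ · ι_*((⊗_w ν_w) ⊗ μ₁)`
for the group isomorphism `ι(o, a) = (ψ⁻¹ e⁻¹ o, a)` and a Haar measure `μ₁` on the compact abelian factor (uniqueness of Haar measure, Mathlib `isMulLeftInvariant_eq_smul`), under which
the conjugation integral becomes `μ₁(U(Φ₁)_∞) · ∫_{Π_w G_w} aH(ψ⁻¹ e⁻¹(o·t̂·o⁻¹), δ) d(⊗ ν_w)` (the abelian factor conjugates trivially, Mathlib `integral_fun_fst`); (iv) `(⊗_w ν_w) ∘ conj_{t̂}⁻¹ =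
⊗_w (ν_w ∘ conj_{t̂_w}⁻¹)` (Mathlib `Measure.pi_map_pi`).

WHAT IS PROVED (FILE B; the class list (i) is FILE A ★ `ArchEndoscopicStableClasses`: `setOf_isArchStablyConjH_out_eq_range`, `injective_conjClassesMk_flip`).
§3 Haar currency: `integral_comp_conj_out_conjClassesMk` (representative independence), `compactSpace_archOne`, `conj_eq_self_archOne`, **`exists_integral_comp_conj_eq_mul_integral_pi`** — ONE
   `κ > 0` with `∫_{H_∞} f(h·(ψ⁻¹ e⁻¹ t, δ)·h⁻¹) dνH = κ · ∫ f(ψ⁻¹ e⁻¹ (o·t·o⁻¹), δ) d(⊗_w ν_w)(o)` for EVERY `f`, `t ∈ Π_w G_w`, `δ` (no measurability needed).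
§4 **`exists_finsum_integral_comp_conj_eq_mul_sum_integral_pi`** — the head (3H) above; and its restatement **`…_univ`** with the measure family written LITERALLY as ★ (E2)'s
   `M(S, u, ε)` (the `if w ∈ S then orbit measure else Dirac` lambda, `S` a variable with `hS : S = Finset.univ`), so that STEP 3's assembly feeds ★ `sum_integral_pi_erase_eq_zero_of_eventuallyEq` by `rw`.
§5 the adapter to B-p12's Cayley frame (STEP-3 node (b), pen F0P3a-p03): `map_embedding_quasiSplitFrameTwo` (`σ_w(Q₂) = C`), `cayleyTwo_inv_mul_circleDiagonal_mul` (`C⁻¹ D C = C D C⁻¹`), and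
   **`archCongrOfEq_quasiSplitFrameTwo_symm_archDiagTorus`**: `Φ_{Q₂}⁻¹ t(u) = e⁻¹ (w ↦ C·diag(u_w)·C⁻¹)` — the point at which ★ p05 `exists_flat_gSide_centralCurve` and the STEP-3 skeleton are written.
HONEST LABEL: HC_CM is proved only modulo the 7 printed citations until rung 0 closes; this file is group∕measure bookkeeping and pays nothing by itself.

## References
* [Rogawski1990] J. D. Rogawski, *Automorphic Representations of Unitary Groups in Three Variables*, Ann. of Math. Stud. 123 (1990), §3.1 p. 19, §3.7 Prop. 3.7.1 pp. 29–30 (classes in a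
  stable class), §4.9 p. 54 (`H = U(2) × U(1)`), §14.3 p. 234 (`H_∞`), §14.5 Lemma 14.5.2 (c) p. 238, §1.7 p. 6 (measures).
* [BorelJacquet1979] A. Borel, H. Jacquet, *Automorphic forms and automorphic representations*, PSPM 33.1 (1979), §4.1 (`G_∞ = Π_v G_v`, product measures).
* [Gelbart1975] S. Gelbart, *Automorphic Forms on Adele Groups*, Ann. of Math. Stud. 83 (1975), p. 155 (10.19) (orbital integrals over an abelian factor).
* [DeitmarEchterhoff2014] A. Deitmar, S. Echterhoff, *Principles of Harmonic Analysis*, 2nd ed. (2014), Thm. 1.5.3 (uniqueness of Haar measure).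
-/

set_option autoImplicit false

noncomputable section

open MeasureTheory Measure Filter Topology NumberField NumberField.InfinitePlace NumberField.mixedEmbedding Set Function
open Literature.MeasureTheory.Group Literature.NumberTheory.Rogawski1990
open scoped Matrix MatrixGroups NNReal ENNReal ComplexOrder

namespace Literature.NumberTheory.Automorphic

namespace UnitaryGroup

/-! ## §3 Haar currency on `H_∞`: representatives, and the factorisation of `νH` through `(Π_w G_w) × U(Φ₁)_∞` -/

section Representative

/-- **The Haar-currency orbital integral at a class does not depend on the representative**: `∫_G f(g·out⟦x⟧·g⁻¹) dμ = ∫_G f(g·x·g⁻¹) dμ` for a right-invariant `μ`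
(`out⟦x⟧ = k x k⁻¹`, substitute `g ↦ g k`). [cite: Rogawski1990, §1.7 p. 6; §4.3 (4.3.1) p. 43] -/
theorem integral_comp_conj_out_conjClassesMk {G : Type*} [Group G] [TopologicalSpace G] [IsTopologicalGroup G] [MeasurableSpace G] [BorelSpace G]
    (μ : Measure G) [μ.IsMulRightInvariant] {E : Type*} [NormedAddCommGroup E] [NormedSpace ℝ E] (f : G → E) (x : G) :
    ∫ g, f (g * Quotient.out (ConjClasses.mk x) * g⁻¹) ∂μ = ∫ g, f (g * x * g⁻¹) ∂μ := by
  obtain ⟨k, hk⟩ := isConj_iff.1 (ConjClasses.mk_eq_mk_iff_isConj.1 (Quotient.out_eq (ConjClasses.mk x)).symm)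
  rw [← hk]
  calc ∫ g, f (g * (k * x * k⁻¹) * g⁻¹) ∂μ = ∫ g, (fun g => f (g * x * g⁻¹)) (g * k) ∂μ := by
        congr 1
        funext g
        simp only [mul_assoc, mul_inv_rev]
    _ = ∫ g, f (g * x * g⁻¹) ∂μ := integral_mul_right_eq_self (fun g => f (g * x * g⁻¹)) k

end Representative

section ArchOne

variable (L : Type) [Field L] [NumberField L] [IsCMField L]

/-- `U(Φ₁)(L ⊗ ℝ) ≅ Π_w U(1)` is compact (★ `isCompact_arch_cm`: `σ_w Φ₁ = (1)` is definite). [cite: PlatonovRapinchuk1994, §3.2 Thm 3.1] [cite: Rogawski1990, §4.9 p. 54] -/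
theorem compactSpace_archOne :
    CompactSpace (arch (↥(maximalRealSubfield L)) L (IsCMField.complexConj L) 1 (Matrix.of fun i j : Fin 1 => if i.val + j.val + 1 = 1 then (1 : L) else 0)) := by
  refine isCompact_iff_compactSpace.mp (isCompact_arch_cm (L := L) (N := 1)
    (H := (Matrix.of fun i j : Fin 1 => if i.val + j.val + 1 = 1 then (1 : L) else 0)) fun w => Or.inl ?_)
  rw [antidiagOne_map, Matrix.diagonal_one]
  exact Matrix.PosDef.one

/-- Conjugation is trivial in the abelian factor `U(Φ₁)(L ⊗ ℝ) ⊂ GL₁(L ⊗ ℝ)`. [cite: Gelbart1975, p. 155 (10.19)] -/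
theorem conj_eq_self_archOne (a δ : arch (↥(maximalRealSubfield L)) L (IsCMField.complexConj L) 1 (Matrix.of fun i j : Fin 1 => if i.val + j.val + 1 = 1 then (1 : L) else 0)) :
    a * δ * a⁻¹ = δ :=
  Subtype.ext (eq_of_isConj_gl_fin_one (isConj_iff.2 ⟨(a : GL (Fin 1) (mixedSpace L)), rfl⟩)).symm

end ArchOne

section Haar

variable (L : Type) [Field L] [NumberField L] [IsCMField L] (α : Fin 2 → L)
  [MeasurableSpace (arch (↥(maximalRealSubfield L)) L (IsCMField.complexConj L) 2 (Matrix.of fun i j : Fin 2 => if i.val + j.val + 1 = 2 then (1 : L) else 0) ×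
      arch (↥(maximalRealSubfield L)) L (IsCMField.complexConj L) 1 (Matrix.of fun i j : Fin 1 => if i.val + j.val + 1 = 1 then (1 : L) else 0))]
  [BorelSpace (arch (↥(maximalRealSubfield L)) L (IsCMField.complexConj L) 2 (Matrix.of fun i j : Fin 2 => if i.val + j.val + 1 = 2 then (1 : L) else 0) ×
      arch (↥(maximalRealSubfield L)) L (IsCMField.complexConj L) 1 (Matrix.of fun i j : Fin 1 => if i.val + j.val + 1 = 1 then (1 : L) else 0))]
  [∀ w : {w : InfinitePlace L // IsComplex w}, MeasurableSpace (archLocal L 2 (Matrix.diagonal α) w)]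
  [∀ w : {w : InfinitePlace L // IsComplex w}, BorelSpace (archLocal L 2 (Matrix.diagonal α) w)]
  (νH : Measure (arch (↥(maximalRealSubfield L)) L (IsCMField.complexConj L) 2 (Matrix.of fun i j : Fin 2 => if i.val + j.val + 1 = 2 then (1 : L) else 0) ×
      arch (↥(maximalRealSubfield L)) L (IsCMField.complexConj L) 1 (Matrix.of fun i j : Fin 1 => if i.val + j.val + 1 = 1 then (1 : L) else 0)))
  [νH.IsHaarMeasure]
  (νw : ∀ w : {w : InfinitePlace L // IsComplex w}, Measure (archLocal L 2 (Matrix.diagonal α) w)) [∀ w, (νw w).IsHaarMeasure]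
  (ψ : arch (↥(maximalRealSubfield L)) L (IsCMField.complexConj L) 2 (Matrix.of fun i j : Fin 2 => if i.val + j.val + 1 = 2 then (1 : L) else 0) ≃ₜ*
    arch (↥(maximalRealSubfield L)) L (IsCMField.complexConj L) 2 (Matrix.diagonal α))

open scoped Classical in
/-- **THE HAAR MEASURE OF `H_∞` FACTORS THROUGH `(Π_w G_w) × U(Φ₁)_∞`.**  There is ONE `κ > 0` (depending on `νH`, the `ν_w` and `ψ` only) such that for EVERY `f : H_∞ → ℂ`, every
`t ∈ Π_w G_w` and every `δ ∈ U(Φ₁)_∞`:  `∫_{H_∞} f(h·(ψ⁻¹e⁻¹ t, δ)·h⁻¹) dνH(h) = κ · ∫_{Π_w G_w} f(ψ⁻¹ e⁻¹(o·t·o⁻¹), δ) d(⊗_w ν_w)(o)` — uniqueness of Haar measure applied to the transport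
`ι_*((⊗ν_w) ⊗ μ₁)` along the group isomorphism `ι(o, a) = (ψ⁻¹ e⁻¹ o, a)` (Mathlib `isMulLeftInvariant_eq_smul`), then the compact abelian factor integrates out to its mass (`integral_fun_fst`);
no measurability is needed (all steps are exact). [cite: Rogawski1990, §1.7 p. 6; §14.3 p. 234] [cite: BorelJacquet1979, §4.1] [cite: Gelbart1975, p. 155 (10.19)] [cite: DeitmarEchterhoff2014, Thm. 1.5.3] -/
theorem exists_integral_comp_conj_eq_mul_integral_pi :
    ∃ κ : ℝ, 0 < κ ∧
      ∀ (f : arch (↥(maximalRealSubfield L)) L (IsCMField.complexConj L) 2 (Matrix.of fun i j : Fin 2 => if i.val + j.val + 1 = 2 then (1 : L) else 0) ×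
            arch (↥(maximalRealSubfield L)) L (IsCMField.complexConj L) 1 (Matrix.of fun i j : Fin 1 => if i.val + j.val + 1 = 1 then (1 : L) else 0) → ℂ)
        (t : ∀ w : {w : InfinitePlace L // IsComplex w}, archLocal L 2 (Matrix.diagonal α) w)
        (δ : arch (↥(maximalRealSubfield L)) L (IsCMField.complexConj L) 1 (Matrix.of fun i j : Fin 1 => if i.val + j.val + 1 = 1 then (1 : L) else 0)),
        ∫ h, f (h * (ψ.symm ((archPiEquivCM 2 L (Matrix.diagonal α)).symm t), δ) * h⁻¹) ∂νH =
          (κ : ℂ) * ∫ o, f (ψ.symm ((archPiEquivCM 2 L (Matrix.diagonal α)).symm (o * t * o⁻¹)), δ) ∂(Measure.pi νw) := by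
  haveI : ∀ w : {w : InfinitePlace L // IsComplex w}, SecondCountableTopology (archLocal L 2 (Matrix.diagonal α) w) :=
    fun w => secondCountableTopology_archLocal L 2 (Matrix.diagonal α) w
  haveI : ∀ w : {w : InfinitePlace L // IsComplex w}, LocallyCompactSpace (archLocal L 2 (Matrix.diagonal α) w) :=
    fun w => locallyCompactSpace_archLocal L 2 (Matrix.diagonal α) w
  -- the abelian factor: Borel structure, compactness, a Haar measure `μ₁`
  letI m₁ : MeasurableSpace (arch (↥(maximalRealSubfield L)) L (IsCMField.complexConj L) 1 (Matrix.of fun i j : Fin 1 => if i.val + j.val + 1 = 1 then (1 : L) else 0)) := borel _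
  haveI : BorelSpace (arch (↥(maximalRealSubfield L)) L (IsCMField.complexConj L) 1 (Matrix.of fun i j : Fin 1 => if i.val + j.val + 1 = 1 then (1 : L) else 0)) := ⟨rfl⟩
  haveI := compactSpace_archOne L
  set μ₁ : Measure (arch (↥(maximalRealSubfield L)) L (IsCMField.complexConj L) 1 (Matrix.of fun i j : Fin 1 => if i.val + j.val + 1 = 1 then (1 : L) else 0)) :=
    Measure.haar with hμ₁
  -- the model group `(Π_w G_w) × U(Φ₁)_∞` and the isomorphism `ι`
  set e := archPiEquivCM 2 L (Matrix.diagonal α) with he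
  set θ : (∀ w : {w : InfinitePlace L // IsComplex w}, archLocal L 2 (Matrix.diagonal α) w) ≃ₜ*
      arch (↥(maximalRealSubfield L)) L (IsCMField.complexConj L) 2 (Matrix.of fun i j : Fin 2 => if i.val + j.val + 1 = 2 then (1 : L) else 0) :=
    e.symm.trans ψ.symm with hθ
  let ι : ((∀ w : {w : InfinitePlace L // IsComplex w}, archLocal L 2 (Matrix.diagonal α) w) ×
        arch (↥(maximalRealSubfield L)) L (IsCMField.complexConj L) 1 (Matrix.of fun i j : Fin 1 => if i.val + j.val + 1 = 1 then (1 : L) else 0)) ≃ₜ*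
      (arch (↥(maximalRealSubfield L)) L (IsCMField.complexConj L) 2 (Matrix.of fun i j : Fin 2 => if i.val + j.val + 1 = 2 then (1 : L) else 0) ×
        arch (↥(maximalRealSubfield L)) L (IsCMField.complexConj L) 1 (Matrix.of fun i j : Fin 1 => if i.val + j.val + 1 = 1 then (1 : L) else 0)) :=
    { MulEquiv.prodCongr θ.toMulEquiv (MulEquiv.refl _) with
      continuous_toFun := (θ.continuous.comp continuous_fst).prodMk continuous_snd
      continuous_invFun := (θ.symm.continuous.comp continuous_fst).prodMk continuous_snd }
  have hι : ∀ p : (∀ w : {w : InfinitePlace L // IsComplex w}, archLocal L 2 (Matrix.diagonal α) w) ×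
      arch (↥(maximalRealSubfield L)) L (IsCMField.complexConj L) 1 (Matrix.of fun i j : Fin 1 => if i.val + j.val + 1 = 1 then (1 : L) else 0),
      ι p = (ψ.symm (e.symm p.1), p.2) := fun p => rfl
  set φ := ι.toHomeomorph.toMeasurableEquiv with hφ
  have hφι : (⇑φ : _ → _) = ⇑ι := rfl
  -- `ρ := ι_* ((⊗ ν_w) ⊗ μ₁)` is a Haar measure on `H_∞`; `νH` is a positive multiple of it
  haveI : (Measure.pi νw).IsHaarMeasure := inferInstance
  haveI : IsFiniteMeasure μ₁ := inferInstance
  haveI : ((Measure.pi νw).prod μ₁).IsHaarMeasure := Measure.prod.instIsHaarMeasure _ _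
  set ρ : Measure (arch (↥(maximalRealSubfield L)) L (IsCMField.complexConj L) 2 (Matrix.of fun i j : Fin 2 => if i.val + j.val + 1 = 2 then (1 : L) else 0) ×
        arch (↥(maximalRealSubfield L)) L (IsCMField.complexConj L) 1 (Matrix.of fun i j : Fin 1 => if i.val + j.val + 1 = 1 then (1 : L) else 0)) :=
    ((Measure.pi νw).prod μ₁).map φ with hρ
  haveI : ρ.IsHaarMeasure := by
    rw [hρ, hφι]
    exact ContinuousMulEquiv.isHaarMeasure_map _ ι
  have hint : ∀ F : arch (↥(maximalRealSubfield L)) L (IsCMField.complexConj L) 2 (Matrix.of fun i j : Fin 2 => if i.val + j.val + 1 = 2 then (1 : L) else 0) ×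
        arch (↥(maximalRealSubfield L)) L (IsCMField.complexConj L) 1 (Matrix.of fun i j : Fin 1 => if i.val + j.val + 1 = 1 then (1 : L) else 0) → ℂ,
      ∫ h, F h ∂ρ = ∫ p, F (ι p) ∂((Measure.pi νw).prod μ₁) := fun F => by
    rw [hρ]
    exact integral_map_equiv φ F
  have hνH : νH = haarScalarFactor νH ρ • ρ := isMulLeftInvariant_eq_smul νH ρ
  have hc : 0 < haarScalarFactor νH ρ := haarScalarFactor_pos_of_isHaarMeasure νH ρ
  have hm : 0 < μ₁.real Set.univ := by
    rw [measureReal_def]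
    exact ENNReal.toReal_pos (isOpen_univ.measure_pos μ₁ Set.univ_nonempty).ne' (measure_lt_top μ₁ _).ne
  refine ⟨(haarScalarFactor νH ρ : ℝ) * μ₁.real Set.univ, mul_pos (NNReal.coe_pos.2 hc) hm, fun f t δ => ?_⟩
  -- the conjugation on the model group: the abelian factor does not move
  have hpt : ∀ p : (∀ w : {w : InfinitePlace L // IsComplex w}, archLocal L 2 (Matrix.diagonal α) w) ×
        arch (↥(maximalRealSubfield L)) L (IsCMField.complexConj L) 1 (Matrix.of fun i j : Fin 1 => if i.val + j.val + 1 = 1 then (1 : L) else 0),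
      ι p * (ψ.symm (e.symm t), δ) * (ι p)⁻¹ = (ψ.symm (e.symm (p.1 * t * p.1⁻¹)), δ) := by
    intro p
    have h1 : (ψ.symm (e.symm t), δ) = ι (t, δ) := (hι (t, δ)).symm
    rw [h1, ← map_mul, ← map_inv, ← map_mul, hι]
    exact Prod.ext rfl (conj_eq_self_archOne L p.2 δ)
  calc ∫ h, f (h * (ψ.symm (e.symm t), δ) * h⁻¹) ∂νH
      = ∫ h, f (h * (ψ.symm (e.symm t), δ) * h⁻¹) ∂(haarScalarFactor νH ρ • ρ) := by rw [← hνH]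
    _ = haarScalarFactor νH ρ • ∫ p, f (ι p * (ψ.symm (e.symm t), δ) * (ι p)⁻¹) ∂((Measure.pi νw).prod μ₁) := by
        rw [integral_smul_nnreal_measure, hint]
    _ = haarScalarFactor νH ρ • ∫ p, (fun o : (∀ w : {w : InfinitePlace L // IsComplex w}, archLocal L 2 (Matrix.diagonal α) w) =>
          f (ψ.symm (e.symm (o * t * o⁻¹)), δ)) p.1 ∂((Measure.pi νw).prod μ₁) := by
        congr 1
        refine integral_congr_ae (Filter.Eventually.of_forall fun p => ?_)
        simp only [hpt p]
    _ = haarScalarFactor νH ρ • (μ₁.real Set.univ • ∫ o, f (ψ.symm (e.symm (o * t * o⁻¹)), δ) ∂(Measure.pi νw)) := by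
        have h2 := integral_fun_fst (μ := Measure.pi νw) (ν := μ₁)
          (fun o : (∀ w : {w : InfinitePlace L // IsComplex w}, archLocal L 2 (Matrix.diagonal α) w) => f (ψ.symm (e.symm (o * t * o⁻¹)), δ))
        rw [h2]
    _ = (((haarScalarFactor νH ρ : ℝ) * μ₁.real Set.univ : ℝ) : ℂ) * ∫ o, f (ψ.symm (e.symm (o * t * o⁻¹)), δ) ∂(Measure.pi νw) := by
        rw [NNReal.smul_def, smul_smul, Complex.real_smul]

end Haar

/-! ## §4 The head (3H) -/

section Head

variable (L : Type) [Field L] [NumberField L] [IsCMField L] (α : Fin 2 → L)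

open scoped Classical in
/-- **(3H) THE `H`-SIDE CLASS BOOKKEEPING AT A REGULAR TORUS POINT OF `H_∞`.**  Frame: `α` diagonal hermitian non-degenerate with `re σ_w(α₀) · re σ_w(α₁) < 0` at EVERY complex place
(the diagonalised endoscopic 2-block `β₂ = (½, −½)` of ★ (R3-a)), `ψ : U(Φ₂)_∞ ≃ₜ* U(diag α)_∞` conjugating by some `T ∈ GL₂(L ⊗ ℝ)`, Haar measures `νH` on `H_∞` and `ν_w` on the local
2-blocks.  Then there is ONE `κ > 0` such that for every measurable `aH : H_∞ → ℂ`, every regular `u : W → Fin 2 → S¹` (`u_w 0 ≠ u_w 1`) and every `δ ∈ U(Φ₁)_∞`, at `γ_H := (ψ⁻¹ t(u), δ)`: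
`∑ᶠ_{c : γ_H ∼st out c} ∫_{H_∞} aH(h·out c·h⁻¹) dνH(h) = κ · Σ_{ε : W → Bool} ∫ aH(ψ⁻¹ e⁻¹ o, δ) d(⊗_w conj(diag(u_w^{ε_w}))_* ν_w)(o)`, `u_w^{tt} = u_w ∘ swap`, `e = archPiEquivCM`.
LEFT side = the `H`-side of ★ (E1) `finsum_integral_comp_conj_eq_finsum_delta_mul_integral_comp_conj_of_isArchDeltaTransfer`; RIGHT side = ★ (E2)'s symmetrised mixed orbital integral at
`S =` all places (see `…_univ`). [cite: Rogawski1990, §3.7 Prop. 3.7.1 pp. 29–30; §4.9 p. 54; §14.3 p. 234; §14.5 p. 238] [cite: BorelJacquet1979, §4.1] [cite: Gelbart1975, p. 155 (10.19)] -/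
theorem exists_finsum_integral_comp_conj_eq_mul_sum_integral_pi
    (hα : ∀ i, α i ≠ 0) (hherm : ∀ i, (IsCMField.complexConj L (α i) : L) = α i)
    (hsgn : ∀ w : {w : InfinitePlace L // IsComplex w}, (w.1.embedding (α 0)).re * (w.1.embedding (α 1)).re < 0)
    [MeasurableSpace (arch (↥(maximalRealSubfield L)) L (IsCMField.complexConj L) 2 (Matrix.of fun i j : Fin 2 => if i.val + j.val + 1 = 2 then (1 : L) else 0) ×
        arch (↥(maximalRealSubfield L)) L (IsCMField.complexConj L) 1 (Matrix.of fun i j : Fin 1 => if i.val + j.val + 1 = 1 then (1 : L) else 0))]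
    [BorelSpace (arch (↥(maximalRealSubfield L)) L (IsCMField.complexConj L) 2 (Matrix.of fun i j : Fin 2 => if i.val + j.val + 1 = 2 then (1 : L) else 0) ×
        arch (↥(maximalRealSubfield L)) L (IsCMField.complexConj L) 1 (Matrix.of fun i j : Fin 1 => if i.val + j.val + 1 = 1 then (1 : L) else 0))]
    [∀ w : {w : InfinitePlace L // IsComplex w}, MeasurableSpace (archLocal L 2 (Matrix.diagonal α) w)]
    [∀ w : {w : InfinitePlace L // IsComplex w}, BorelSpace (archLocal L 2 (Matrix.diagonal α) w)]
    (νH : Measure (arch (↥(maximalRealSubfield L)) L (IsCMField.complexConj L) 2 (Matrix.of fun i j : Fin 2 => if i.val + j.val + 1 = 2 then (1 : L) else 0) ×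
        arch (↥(maximalRealSubfield L)) L (IsCMField.complexConj L) 1 (Matrix.of fun i j : Fin 1 => if i.val + j.val + 1 = 1 then (1 : L) else 0)))
    [νH.IsHaarMeasure] [νH.IsMulRightInvariant]
    (νw : ∀ w : {w : InfinitePlace L // IsComplex w}, Measure (archLocal L 2 (Matrix.diagonal α) w)) [∀ w, (νw w).IsHaarMeasure]
    (T : GL (Fin 2) (mixedSpace L))
    (ψ : arch (↥(maximalRealSubfield L)) L (IsCMField.complexConj L) 2 (Matrix.of fun i j : Fin 2 => if i.val + j.val + 1 = 2 then (1 : L) else 0) ≃ₜ*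
      arch (↥(maximalRealSubfield L)) L (IsCMField.complexConj L) 2 (Matrix.diagonal α))
    (hψ : ∀ x, ((ψ x : arch (↥(maximalRealSubfield L)) L (IsCMField.complexConj L) 2 (Matrix.diagonal α)) : GL (Fin 2) (mixedSpace L)) =
      T * (x : GL (Fin 2) (mixedSpace L)) * T⁻¹) :
    ∃ κ : ℝ, 0 < κ ∧
      ∀ (aH : arch (↥(maximalRealSubfield L)) L (IsCMField.complexConj L) 2 (Matrix.of fun i j : Fin 2 => if i.val + j.val + 1 = 2 then (1 : L) else 0) ×
          arch (↥(maximalRealSubfield L)) L (IsCMField.complexConj L) 1 (Matrix.of fun i j : Fin 1 => if i.val + j.val + 1 = 1 then (1 : L) else 0) → ℂ),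
        Measurable aH →
      ∀ (u : {w : InfinitePlace L // IsComplex w} → Fin 2 → Circle), (∀ w, u w 0 ≠ u w 1) →
      ∀ δ : arch (↥(maximalRealSubfield L)) L (IsCMField.complexConj L) 1 (Matrix.of fun i j : Fin 1 => if i.val + j.val + 1 = 1 then (1 : L) else 0),
        ∑ᶠ c ∈ {c : ConjClasses (arch (↥(maximalRealSubfield L)) L (IsCMField.complexConj L) 2 (Matrix.of fun i j : Fin 2 => if i.val + j.val + 1 = 2 then (1 : L) else 0) ×
            arch (↥(maximalRealSubfield L)) L (IsCMField.complexConj L) 1 (Matrix.of fun i j : Fin 1 => if i.val + j.val + 1 = 1 then (1 : L) else 0)) |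
              IsArchStablyConjH L (ψ.symm (archDiagTorus L 2 α u), δ) (Quotient.out c)},
            ∫ h, aH (h * Quotient.out c * h⁻¹) ∂νH =
          (κ : ℂ) * ∑ ε : {w : InfinitePlace L // IsComplex w} → Bool,
            ∫ o, aH (ψ.symm ((archPiEquivCM 2 L (Matrix.diagonal α)).symm o), δ)
              ∂(Measure.pi fun w : {w : InfinitePlace L // IsComplex w} => (νw w).map (fun g : archLocal L 2 (Matrix.diagonal α) w =>
                g * ⟨circleDiagonal 2 (if ε w then u w ∘ ⇑(Equiv.swap (0 : Fin 2) 1) else u w), circleDiagonal_mem_archLocal_diagonal L 2 α w _⟩ * g⁻¹)) := by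
  obtain ⟨κ, hκ, hmain⟩ := exists_integral_comp_conj_eq_mul_integral_pi L α νH νw ψ
  refine ⟨κ, hκ, fun aH haH u hu δ => ?_⟩
  haveI : ∀ w : {w : InfinitePlace L // IsComplex w}, SecondCountableTopology (archLocal L 2 (Matrix.diagonal α) w) :=
    fun w => secondCountableTopology_archLocal L 2 (Matrix.diagonal α) w
  haveI : ∀ w : {w : InfinitePlace L // IsComplex w}, LocallyCompactSpace (archLocal L 2 (Matrix.diagonal α) w) :=
    fun w => locallyCompactSpace_archLocal L 2 (Matrix.diagonal α) w
  -- (i) the classes are the flips, (v) the finite sum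
  rw [setOf_isArchStablyConjH_out_eq_range L α T ψ hψ hα hherm u hu δ, finsum_mem_range (injective_conjClassesMk_flip L α ψ hα hherm hsgn u hu δ),
    finsum_eq_sum_of_fintype, Finset.mul_sum]
  refine Finset.sum_congr rfl fun ε _ => ?_
  -- (ii) representative, (iii) Haar factorisation
  rw [integral_comp_conj_out_conjClassesMk, archDiagTorus_eq_symm_apply, hmain aH _ δ]
  congr 1
  -- (iv) the push-forward `(⊗ν_w) ∘ conj⁻¹ = ⊗ (ν_w ∘ conj_w⁻¹)`
  have hzε : ∀ w : {w : InfinitePlace L // IsComplex w}, Function.Injective (if ε w then u w ∘ ⇑(Equiv.swap (0 : Fin 2) 1) else u w) := by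
    intro w
    by_cases hw : ε w
    · simp only [hw, ↓reduceIte]
      exact injective_of_apply_zero_ne_apply_one _ (comp_swap_apply_zero_ne _ (hu w))
    · simp only [hw, Bool.false_eq_true, ↓reduceIte]
      exact injective_of_apply_zero_ne_apply_one _ (hu w)
  haveI hσ : ∀ w : {w : InfinitePlace L // IsComplex w}, SigmaFinite ((νw w).map (fun g : archLocal L 2 (Matrix.diagonal α) w =>
      g * ⟨circleDiagonal 2 (if ε w then u w ∘ ⇑(Equiv.swap (0 : Fin 2) 1) else u w), circleDiagonal_mem_archLocal_diagonal L 2 α w _⟩ * g⁻¹)) := by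
    intro w
    haveI := isFiniteMeasureOnCompacts_map_conj_circleDiagonal L 2 α w hα _ (hzε w) (νw w)
    infer_instance
  have hmeas : ∀ w : {w : InfinitePlace L // IsComplex w}, AEMeasurable (fun g : archLocal L 2 (Matrix.diagonal α) w =>
      g * ⟨circleDiagonal 2 (if ε w then u w ∘ ⇑(Equiv.swap (0 : Fin 2) 1) else u w), circleDiagonal_mem_archLocal_diagonal L 2 α w _⟩ * g⁻¹) (νw w) :=
    fun w => ((continuous_id.mul continuous_const).mul continuous_id.inv).measurable.aemeasurable
  rw [← Measure.pi_map_pi hmeas, integral_map]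
  · rfl
  · have hcont : Continuous (fun (x : ∀ w : {w : InfinitePlace L // IsComplex w}, archLocal L 2 (Matrix.diagonal α) w) (w : {w : InfinitePlace L // IsComplex w}) =>
        x w * ⟨circleDiagonal 2 (if ε w then u w ∘ ⇑(Equiv.swap (0 : Fin 2) 1) else u w), circleDiagonal_mem_archLocal_diagonal L 2 α w _⟩ * (x w)⁻¹) :=
      continuous_pi fun w => ((continuous_apply w).mul continuous_const).mul (continuous_apply w).inv
    exact hcont.measurable.aemeasurable
  · refine (haH.comp ?_).aestronglyMeasurable
    exact ((ψ.symm.continuous.comp (archPiEquivCM 2 L (Matrix.diagonal α)).symm.continuous).prodMk continuous_const).measurable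

open scoped Classical in
/-- **(3H) IN ★ (E2)'s LITERAL CURRENCY.**  The same identity with the measure family written EXACTLY as ★ `ArchEndoscopicCentralDescent` writes `M(S, u, ε)` — `if w ∈ S then` orbit measure
`else` Dirac mass at the centre `diag(z_w, z_w)` — at `S = Finset.univ` (the Dirac branch is dead; `S` is kept a variable with `hS : S = univ` so that the elaborated family is token-identical
to (E2)'s and STEP 3 feeds `sum_integral_pi_erase_eq_zero_of_eventuallyEq` at `S = univ, w₁ = w₀` by `rw`). [cite: Rogawski1990, §14.5 Lemma 14.5.2 (c) p. 238] [cite: BorelJacquet1979, §4.1] -/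
theorem exists_finsum_integral_comp_conj_eq_mul_sum_integral_pi_univ
    (hα : ∀ i, α i ≠ 0) (hherm : ∀ i, (IsCMField.complexConj L (α i) : L) = α i)
    (hsgn : ∀ w : {w : InfinitePlace L // IsComplex w}, (w.1.embedding (α 0)).re * (w.1.embedding (α 1)).re < 0)
    [MeasurableSpace (arch (↥(maximalRealSubfield L)) L (IsCMField.complexConj L) 2 (Matrix.of fun i j : Fin 2 => if i.val + j.val + 1 = 2 then (1 : L) else 0) ×
        arch (↥(maximalRealSubfield L)) L (IsCMField.complexConj L) 1 (Matrix.of fun i j : Fin 1 => if i.val + j.val + 1 = 1 then (1 : L) else 0))]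
    [BorelSpace (arch (↥(maximalRealSubfield L)) L (IsCMField.complexConj L) 2 (Matrix.of fun i j : Fin 2 => if i.val + j.val + 1 = 2 then (1 : L) else 0) ×
        arch (↥(maximalRealSubfield L)) L (IsCMField.complexConj L) 1 (Matrix.of fun i j : Fin 1 => if i.val + j.val + 1 = 1 then (1 : L) else 0))]
    [∀ w : {w : InfinitePlace L // IsComplex w}, MeasurableSpace (archLocal L 2 (Matrix.diagonal α) w)]
    [∀ w : {w : InfinitePlace L // IsComplex w}, BorelSpace (archLocal L 2 (Matrix.diagonal α) w)]
    (νH : Measure (arch (↥(maximalRealSubfield L)) L (IsCMField.complexConj L) 2 (Matrix.of fun i j : Fin 2 => if i.val + j.val + 1 = 2 then (1 : L) else 0) ×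
        arch (↥(maximalRealSubfield L)) L (IsCMField.complexConj L) 1 (Matrix.of fun i j : Fin 1 => if i.val + j.val + 1 = 1 then (1 : L) else 0)))
    [νH.IsHaarMeasure] [νH.IsMulRightInvariant]
    (νw : ∀ w : {w : InfinitePlace L // IsComplex w}, Measure (archLocal L 2 (Matrix.diagonal α) w)) [∀ w, (νw w).IsHaarMeasure]
    (T : GL (Fin 2) (mixedSpace L))
    (ψ : arch (↥(maximalRealSubfield L)) L (IsCMField.complexConj L) 2 (Matrix.of fun i j : Fin 2 => if i.val + j.val + 1 = 2 then (1 : L) else 0) ≃ₜ*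
      arch (↥(maximalRealSubfield L)) L (IsCMField.complexConj L) 2 (Matrix.diagonal α))
    (hψ : ∀ x, ((ψ x : arch (↥(maximalRealSubfield L)) L (IsCMField.complexConj L) 2 (Matrix.diagonal α)) : GL (Fin 2) (mixedSpace L)) =
      T * (x : GL (Fin 2) (mixedSpace L)) * T⁻¹)
    (z : {w : InfinitePlace L // IsComplex w} → Circle) (S : Finset {w : InfinitePlace L // IsComplex w}) (hS : S = Finset.univ) :
    ∃ κ : ℝ, 0 < κ ∧
      ∀ (aH : arch (↥(maximalRealSubfield L)) L (IsCMField.complexConj L) 2 (Matrix.of fun i j : Fin 2 => if i.val + j.val + 1 = 2 then (1 : L) else 0) ×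
          arch (↥(maximalRealSubfield L)) L (IsCMField.complexConj L) 1 (Matrix.of fun i j : Fin 1 => if i.val + j.val + 1 = 1 then (1 : L) else 0) → ℂ),
        Measurable aH →
      ∀ (u : {w : InfinitePlace L // IsComplex w} → Fin 2 → Circle), (∀ w, u w 0 ≠ u w 1) →
      ∀ δ : arch (↥(maximalRealSubfield L)) L (IsCMField.complexConj L) 1 (Matrix.of fun i j : Fin 1 => if i.val + j.val + 1 = 1 then (1 : L) else 0),
        ∑ᶠ c ∈ {c : ConjClasses (arch (↥(maximalRealSubfield L)) L (IsCMField.complexConj L) 2 (Matrix.of fun i j : Fin 2 => if i.val + j.val + 1 = 2 then (1 : L) else 0) ×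
            arch (↥(maximalRealSubfield L)) L (IsCMField.complexConj L) 1 (Matrix.of fun i j : Fin 1 => if i.val + j.val + 1 = 1 then (1 : L) else 0)) |
              IsArchStablyConjH L (ψ.symm (archDiagTorus L 2 α u), δ) (Quotient.out c)},
            ∫ h, aH (h * Quotient.out c * h⁻¹) ∂νH =
          (κ : ℂ) * ∑ ε : {w : InfinitePlace L // IsComplex w} → Bool,
            ∫ o, aH (ψ.symm ((archPiEquivCM 2 L (Matrix.diagonal α)).symm o), δ)
              ∂(Measure.pi (fun w : {w : InfinitePlace L // IsComplex w} =>
                if w ∈ S then (νw w).map (fun g : archLocal L 2 (Matrix.diagonal α) w =>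
                  g * ⟨circleDiagonal 2 (if ε w then u w ∘ ⇑(Equiv.swap (0 : Fin 2) 1) else u w), circleDiagonal_mem_archLocal_diagonal L 2 α w _⟩ * g⁻¹)
                else Measure.dirac (⟨circleDiagonal 2 ![z w, z w], circleDiagonal_mem_archLocal_diagonal L 2 α w _⟩ : archLocal L 2 (Matrix.diagonal α) w))) := by
  obtain ⟨κ, hκ, hmain⟩ := exists_finsum_integral_comp_conj_eq_mul_sum_integral_pi L α hα hherm hsgn νH νw T ψ hψ
  refine ⟨κ, hκ, fun aH haH u hu δ => ?_⟩
  subst hS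
  have hfam : ∀ ε : {w : InfinitePlace L // IsComplex w} → Bool,
      (fun w : {w : InfinitePlace L // IsComplex w} =>
          if w ∈ (Finset.univ : Finset {w : InfinitePlace L // IsComplex w}) then (νw w).map (fun g : archLocal L 2 (Matrix.diagonal α) w =>
            g * ⟨circleDiagonal 2 (if ε w then u w ∘ ⇑(Equiv.swap (0 : Fin 2) 1) else u w), circleDiagonal_mem_archLocal_diagonal L 2 α w _⟩ * g⁻¹)
          else Measure.dirac (⟨circleDiagonal 2 ![z w, z w], circleDiagonal_mem_archLocal_diagonal L 2 α w _⟩ : archLocal L 2 (Matrix.diagonal α) w)) =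
        fun w : {w : InfinitePlace L // IsComplex w} => (νw w).map (fun g : archLocal L 2 (Matrix.diagonal α) w =>
          g * ⟨circleDiagonal 2 (if ε w then u w ∘ ⇑(Equiv.swap (0 : Fin 2) 1) else u w), circleDiagonal_mem_archLocal_diagonal L 2 α w _⟩ * g⁻¹) :=
    fun ε => funext fun w => if_pos (Finset.mem_univ w)
  simp only [hfam]
  exact hmain aH haH u hu δ

end Head

/-! ## §5 The adapter to B-p12's Cayley frame: the congruence pre-image of the torus point IS the per-place Cayley point -/

section Adapter

variable (L : Type) [Field L] [NumberField L] [IsCMField L]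

omit [IsCMField L] in
/-- `σ_w(Q₂) = (1 1; 1 −1)` in `GL₂(ℂ)`: the rational frame `Q₂` of ★ (R3-a) is B-p12's Cayley frame at every complex place. [cite: Rogawski1990, §8.2 p. 122; §4.9 p. 54] -/
theorem map_embedding_quasiSplitFrameTwo (w : {w : InfinitePlace L // IsComplex w}) :
    Matrix.GeneralLinearGroup.map (w.1.embedding : L →+* ℂ) (Matrix.GeneralLinearGroup.mkOfDetNeZero !![(1 : L), 1; 1, -1] (det_quasiSplitFrameTwo_ne_zero L)) =
      Matrix.GeneralLinearGroup.mkOfDetNeZero !![(1 : ℂ), 1; 1, -1] det_cayleyTwo_ne_zero := by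
  apply Units.ext
  ext i j
  change (w.1.embedding : L →+* ℂ) ((!![(1 : L), 1; 1, -1]) i j) = (!![(1 : ℂ), 1; 1, -1]) i j
  fin_cases i <;> fin_cases j <;> simp

/-- `C⁻¹ · D · C = C · D · C⁻¹` for the Cayley frame `C = (1 1; 1 −1)` (`C² = 2·1`, ★ `coe_inv_cayleyTwo`) and a diagonal torus point `D = diag(z)`. [cite: Rogawski1990, §8.2 p. 122] -/
theorem cayleyTwo_inv_mul_circleDiagonal_mul (z : Fin 2 → Circle) :
    (Matrix.GeneralLinearGroup.mkOfDetNeZero !![(1 : ℂ), 1; 1, -1] det_cayleyTwo_ne_zero)⁻¹ * circleDiagonal 2 z *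
        Matrix.GeneralLinearGroup.mkOfDetNeZero !![(1 : ℂ), 1; 1, -1] det_cayleyTwo_ne_zero =
      Matrix.GeneralLinearGroup.mkOfDetNeZero !![(1 : ℂ), 1; 1, -1] det_cayleyTwo_ne_zero * circleDiagonal 2 z *
        (Matrix.GeneralLinearGroup.mkOfDetNeZero !![(1 : ℂ), 1; 1, -1] det_cayleyTwo_ne_zero)⁻¹ := by
  apply Units.ext
  have hD : (Matrix.diagonal fun i : Fin 2 => ((z i : Circle) : ℂ)) = !![((z 0 : Circle) : ℂ), 0; 0, ((z 1 : Circle) : ℂ)] := by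
    ext i j
    fin_cases i <;> fin_cases j <;> simp
  simp only [Units.val_mul, coe_inv_cayleyTwo, Matrix.GeneralLinearGroup.val_mkOfDetNeZero, coe_circleDiagonal, hD, Matrix.mul_fin_two]
  ext i j
  fin_cases i <;> fin_cases j <;> simp <;> ring

/-- **THE ADAPTER (STEP-3 node (b)).**  For the endoscopic congruence `Φ_{Q₂} : U(Φ₂)_∞ ≃ₜ* U(diag(½,−½))_∞` of ★ (R3-a) (`g ↦ (Q₂ ⊗ 1) g (Q₂ ⊗ 1)⁻¹`) and torus data `u`,
the pre-image `Φ_{Q₂}⁻¹ t(u)` of the diagonal torus point IS B-p12's per-place Cayley point `e⁻¹ (w ↦ C·diag(u_w)·C⁻¹)`, `C = (1 1; 1 −1)` — so the head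
`exists_finsum_integral_comp_conj_eq_mul_sum_integral_pi` (with `α := (½,−½)`, `ψ := Φ_{Q₂}`) reads VERBATIM at the point `γ_H(u)` of ★ p05 `exists_flat_gSide_centralCurve` ∕ the STEP-3 skeleton
(`w`-components by ★ `coe_archAt`; `σ_w(Q₂) = C`; `C⁻¹ D C = C D C⁻¹`). [cite: Rogawski1990, §8.2 p. 122; §4.9 p. 54; §14.5 p. 238] [cite: PlatonovRapinchuk1994, §2.3] -/
theorem archCongrOfEq_quasiSplitFrameTwo_symm_archDiagTorus (u : {w : InfinitePlace L // IsComplex w} → Fin 2 → Circle) :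
    (unitaryGroupOfFormCongrOfEq (conjMixed (↥(maximalRealSubfield L)) L (IsCMField.complexConj L))
          (Matrix.GeneralLinearGroup.map (mixedEmbedding L) (Matrix.GeneralLinearGroup.mkOfDetNeZero !![(1 : L), 1; 1, -1] (det_quasiSplitFrameTwo_ne_zero L)))
          (archFormOf L 2 (Matrix.diagonal ![(2 : L)⁻¹, -(2 : L)⁻¹])) (archFormOf L 2 (Matrix.of fun i j : Fin 2 => if i.val + j.val + 1 = 2 then (1 : L) else 0))
          (formCongr_map_mixedEmbedding_archFormOf_eq L (formCongr_quasiSplitFrameTwo_diagonal L))).symm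
        (archDiagTorus L 2 ![(2 : L)⁻¹, -(2 : L)⁻¹] u) =
      (archPiEquivCM 2 L (Matrix.of fun i j : Fin 2 => if i.val + j.val + 1 = 2 then (1 : L) else 0)).symm fun w =>
        ⟨Matrix.GeneralLinearGroup.mkOfDetNeZero !![(1 : ℂ), 1; 1, -1] det_cayleyTwo_ne_zero * circleDiagonal 2 (u w) *
            (Matrix.GeneralLinearGroup.mkOfDetNeZero !![(1 : ℂ), 1; 1, -1] det_cayleyTwo_ne_zero)⁻¹,
          cayley_conj_circleDiagonal_mem_archLocal L w _⟩ := by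
  apply (archPiEquivCM 2 L (Matrix.of fun i j : Fin 2 => if i.val + j.val + 1 = 2 then (1 : L) else 0)).injective
  rw [ContinuousMulEquiv.apply_symm_apply]
  funext w
  apply Subtype.ext
  -- the `w`-component of the left side, read on `GL₂(ℂ)`
  have h1 : ((archPiEquivCM 2 L (Matrix.of fun i j : Fin 2 => if i.val + j.val + 1 = 2 then (1 : L) else 0)
        ((unitaryGroupOfFormCongrOfEq (conjMixed (↥(maximalRealSubfield L)) L (IsCMField.complexConj L))
          (Matrix.GeneralLinearGroup.map (mixedEmbedding L) (Matrix.GeneralLinearGroup.mkOfDetNeZero !![(1 : L), 1; 1, -1] (det_quasiSplitFrameTwo_ne_zero L)))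
          (archFormOf L 2 (Matrix.diagonal ![(2 : L)⁻¹, -(2 : L)⁻¹])) (archFormOf L 2 (Matrix.of fun i j : Fin 2 => if i.val + j.val + 1 = 2 then (1 : L) else 0))
          (formCongr_map_mixedEmbedding_archFormOf_eq L (formCongr_quasiSplitFrameTwo_diagonal L))).symm
        (archDiagTorus L 2 ![(2 : L)⁻¹, -(2 : L)⁻¹] u)) w :
          archLocal L 2 (Matrix.of fun i j : Fin 2 => if i.val + j.val + 1 = 2 then (1 : L) else 0) w) : GL (Fin 2) ℂ) =
      Matrix.GeneralLinearGroup.map (evalC L w)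
        ((Matrix.GeneralLinearGroup.map (mixedEmbedding L) (Matrix.GeneralLinearGroup.mkOfDetNeZero !![(1 : L), 1; 1, -1] (det_quasiSplitFrameTwo_ne_zero L)))⁻¹ *
          ((archDiagTorus L 2 ![(2 : L)⁻¹, -(2 : L)⁻¹] u : arch (↥(maximalRealSubfield L)) L (IsCMField.complexConj L) 2 (Matrix.diagonal ![(2 : L)⁻¹, -(2 : L)⁻¹])) :
            GL (Fin 2) (mixedSpace L)) *
          Matrix.GeneralLinearGroup.map (mixedEmbedding L) (Matrix.GeneralLinearGroup.mkOfDetNeZero !![(1 : L), 1; 1, -1] (det_quasiSplitFrameTwo_ne_zero L))) := rfl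
  have h2 : Matrix.GeneralLinearGroup.map (evalC L w)
        ((archDiagTorus L 2 ![(2 : L)⁻¹, -(2 : L)⁻¹] u : arch (↥(maximalRealSubfield L)) L (IsCMField.complexConj L) 2 (Matrix.diagonal ![(2 : L)⁻¹, -(2 : L)⁻¹])) :
          GL (Fin 2) (mixedSpace L)) = circleDiagonal 2 (u w) :=
    congrArg (fun g : archLocal L 2 (Matrix.diagonal ![(2 : L)⁻¹, -(2 : L)⁻¹]) w => (g : GL (Fin 2) ℂ)) (archPiEquivCM_archDiagTorus L 2 ![(2 : L)⁻¹, -(2 : L)⁻¹] u w)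
  rw [h1, map_mul, map_mul, map_inv, map_evalC_map_mixedEmbedding, h2, map_embedding_quasiSplitFrameTwo]
  exact cayleyTwo_inv_mul_circleDiagonal_mul (u w)

end Adapter

end UnitaryGroup

end Literature.NumberTheory.Automorphic

end
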